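import Literature.Barriers.ValiantsHypothesis.NumericToSymbolicTransfer
import Mathlib.RingTheory.Nullstellensatz
import HarnessLib

/-!
# Proof of GMOW 2019, Proposition 3.3 (symbolic solutions over `K̄`)

Discharges the named fact `GMOW2019_prop33` of `NumericToSymbolicTransfer.lean`:
`theorem GMOW2019_prop33_holds : GMOW2019_prop33`, following the printed proof (§4.1):
if the system `{L_i(z) = M_i(y)}_i` had no solution over `K̄ = \overline{F(z)}`, Hilbert's
Nullstellensatz gives `∑_i f_i(y) (M_i(y) - L_i(z)) = 1` in `K̄[y]`; the finitely many
coefficients generate, together with the `z_v`, a finitely generated `F`-algebra `T ⊆ K̄`, which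
(Nullstellensatz again, `F` algebraically closed) has an `F`-point `φ : T → F`; with
`β = φ(z)` the identity specialises to `∑_i φ(f_i)(y) (M_i(y) - L_i(β)) = 1` in `F[y]`,
contradicting the solvability of `L(β) = M(y)`.

Implementation: `T` is handled through a presentation `Ψ = aeval gen : F[S] → K̄` (`S` = the
variables and the coefficient slots, a finite type); the `F`-point is `aeval x` for a point `x`
of a maximal ideal above `ker Ψ` (`MvPolynomial.eq_vanishingIdeal_singleton_of_isMaximal`), and
the identity is transported coefficientwise (`map Ψ D = 0 ⇒ map (aeval x) D = 0`).

## References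

* [GargMakamOliveiraWigderson2019] A. Garg, V. Makam, R. Oliveira, A. Wigderson, *More barriers
  for rank methods, via a "numeric to symbolic" transfer*, FOCS 2019 (arXiv:1904.04299), Prop. 3.3
  and its proof in §4.1 (Lemma 4.1, Remark 4.2).
-/

noncomputable section

namespace Literature.Barriers.ValiantsHypothesis

open Literature.Computability.AlgebraicComplexity MvPolynomial
open scoped BigOperators

/-- **Garg–Makam–Oliveira–Wigderson 2019, Proposition 3.3** (discharge of the named fact
`GMOW2019_prop33`). [cite: GargMakamOliveiraWigderson2019, Prop. 3.3 (proof, §4.1)] -/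
theorem GMOW2019_prop33_holds : GMOW2019_prop33 := by
  intro F _ _ σ τ ι _ _ _ L M hLM
  classical
  haveI : Fintype ι := Fintype.ofFinite ι
  by_contra hcon
  push Not at hcon
  -- Step 1: the polynomials `M_i(y) - L_i(z)` over `K̄` have no common zero, so generate `1`
  set zK : σ → AlgebraicClosure (FractionRing (MvPolynomial σ F)) := fun v =>
    algebraMap (MvPolynomial σ F) (AlgebraicClosure (FractionRing (MvPolynomial σ F))) (X v)
    with hzK
  set g : ι → MvPolynomial τ (AlgebraicClosure (FractionRing (MvPolynomial σ F))) :=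
    fun i => MvPolynomial.map (algebraMap F _) (M i) -
      C (algebraMap (MvPolynomial σ F) (AlgebraicClosure (FractionRing (MvPolynomial σ F))) (L i))
    with hg
  have hone : (1 : MvPolynomial τ (AlgebraicClosure (FractionRing (MvPolynomial σ F)))) ∈
      Ideal.span (Set.range g) := by
    have hz : zeroLocus (AlgebraicClosure (FractionRing (MvPolynomial σ F)))
        (Ideal.span (Set.range g)) = ∅ := by
      rw [zeroLocus_span]
      ext b
      simp only [Set.mem_setOf_eq, Set.mem_empty_iff_false, iff_false]
      intro hb
      obtain ⟨i, hi⟩ := hcon b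
      apply hi
      have := hb (g i) ⟨i, rfl⟩
      rw [hg, map_sub, aeval_map_algebraMap, aeval_C, Algebra.algebraMap_self, RingHom.id_apply,
        sub_eq_zero] at this
      exact this.symm
    have hrad := vanishingIdeal_zeroLocus_eq_radical
      (k := AlgebraicClosure (FractionRing (MvPolynomial σ F)))
      (K := AlgebraicClosure (FractionRing (MvPolynomial σ F))) (Ideal.span (Set.range g))
    rw [hz, vanishingIdeal_empty] at hrad
    rw [Ideal.radical_eq_top.1 hrad.symm]
    trivial
  obtain ⟨f, hf⟩ := Ideal.mem_span_range_iff_exists_fun.1 hone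
  -- Step 2: a presentation of the finitely generated algebra `F[z, coefficients of the f_i]`
  let S : Type := σ ⊕ (Σ i : ι, ((f i).support : Type))
  let gen : S → AlgebraicClosure (FractionRing (MvPolynomial σ F)) :=
    Sum.elim zK (fun q => coeff (q.2 : τ →₀ ℕ) (f q.1))
  set Ψ : MvPolynomial S F →ₐ[F] AlgebraicClosure (FractionRing (MvPolynomial σ F)) :=
    aeval gen with hΨ
  -- an `F`-point of its image: a maximal ideal above `ker Ψ` is a point (Nullstellensatz)
  have hker : RingHom.ker (Ψ : MvPolynomial S F →+* AlgebraicClosure (FractionRing (MvPolynomial σ F))) ≠ ⊤ := RingHom.ker_ne_top _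
  obtain ⟨𝔪, h𝔪, hle⟩ := Ideal.exists_le_maximal _ hker
  obtain ⟨x, hx⟩ := eq_vanishingIdeal_singleton_of_isMaximal F h𝔪
  have hkill : ∀ q : MvPolynomial S F, Ψ q = 0 → aeval x q = 0 := by
    intro q hq
    have hq' : q ∈ 𝔪 := hle (by simpa [RingHom.mem_ker] using hq)
    rw [hx, mem_vanishingIdeal_singleton_iff] at hq'
    exact hq'
  -- Step 3: lift the Nullstellensatz certificate along `Ψ`
  let Zv : σ → MvPolynomial S F := fun v => X (Sum.inl v)
  let Fl : ι → MvPolynomial τ (MvPolynomial S F) :=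
    fun i => ∑ e ∈ (f i).support.attach, monomial e.1 (X (Sum.inr ⟨i, e⟩))
  let Ll : ι → MvPolynomial S F := fun i => aeval Zv (L i)
  have hΨZ : ∀ v, Ψ (Zv v) = zK v := fun v => by simp [hΨ, gen, Zv]
  have hΨL : ∀ i, Ψ (Ll i) =
      algebraMap (MvPolynomial σ F) (AlgebraicClosure (FractionRing (MvPolynomial σ F))) (L i) := by
    intro i
    have h1 : Ψ (Ll i) = (Ψ.comp (aeval Zv)) (L i) := rfl
    rw [h1, comp_aeval]
    have h2 : (fun v => Ψ (Zv v)) = zK := funext hΨZ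
    rw [h2, hzK, aeval_algebraMap_X_eq]
  have hΨF : ∀ i, MvPolynomial.map (Ψ : MvPolynomial S F →+* AlgebraicClosure (FractionRing (MvPolynomial σ F))) (Fl i) = f i := by
    intro i
    simp only [Fl, map_sum, map_monomial]
    conv_rhs => rw [(f i).as_sum, ← Finset.sum_attach]
    refine Finset.sum_congr rfl fun e _ => ?_
    congr 1
    simp [hΨ, gen]
  set D : MvPolynomial τ (MvPolynomial S F) :=
    ∑ i, Fl i * (MvPolynomial.map (algebraMap F (MvPolynomial S F)) (M i) - C (Ll i)) - 1 with hD
  have hmapD : MvPolynomial.map (Ψ : MvPolynomial S F →+* AlgebraicClosure (FractionRing (MvPolynomial σ F))) D = 0 := by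
    simp only [hD, map_sub, map_sum, map_mul, map_one, hΨF, map_C, map_map, RingHom.coe_coe,
      hΨL, AlgHom.comp_algebraMap]
    rw [sub_eq_zero, ← hf]
  have hmapD' : MvPolynomial.map ((aeval x : MvPolynomial S F →ₐ[F] F) : MvPolynomial S F →+* F)
      D = 0 := by
    ext e
    rw [coeff_map, coeff_zero]
    apply hkill
    have := congrArg (coeff e) hmapD
    rwa [coeff_map, coeff_zero] at this
  -- Step 4: specialise at `β = x(z)` and evaluate at a solution `γ` of `L(β) = M(γ)`
  set β : σ → F := fun v => aeval x (Zv v) with hβ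
  obtain ⟨γ, hγ⟩ := hLM β
  have hLβ : ∀ i, aeval x (Ll i) = eval β (L i) := by
    intro i
    have h1 : aeval x (Ll i) = ((aeval x).comp (aeval Zv)) (L i) := rfl
    rw [h1, comp_aeval]
    rfl
  have hMid : ∀ i, MvPolynomial.map ((aeval x : MvPolynomial S F →ₐ[F] F) : MvPolynomial S F →+* F)
      (MvPolynomial.map (algebraMap F (MvPolynomial S F)) (M i)) = M i := by
    intro i
    rw [map_map, AlgHom.comp_algebraMap, Algebra.algebraMap_self, map_id]
  have key := congrArg (eval γ) hmapD'
  simp only [hD, map_sub, map_sum, map_mul, map_one, map_C, RingHom.coe_coe, hMid, hLβ,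
    eval_C, hγ, sub_self, mul_zero, Finset.sum_const_zero, zero_sub, map_zero,
    neg_eq_zero] at key
  exact one_ne_zero key

end Literature.Barriers.ValiantsHypothesis
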